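import Summits.Schanuel.Schanuel.Theorems.RootDecomp1ResidueSieveFourExp

/-!
# RootDecomp1QuadricAbsorption — ROUND 18 of route-Schanuel-RootDecomp1 (lens 1 «grading / quantitative ladder», gen 18)

THEOREM ROUND + CORRECTION (`--supports stmt-Schanuel-30353`, item D =
`Summit.Schanuel.Schanuel.Theses.RootDecomp1.DisjointSaturatedEssentialSchanuel`).

## The finding: SCOPE ABSORPTION

Item D carries, as binders, the conclusions of the ladder items it is glued with: binder h4 («`z, e^z` an
algebraic-coefficient LINEAR image of `k` parameters ⟹ `n ≤ k`»), h5 (QUADRATIC image) and h6 (RATIONAL image,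
`z·D(t) = N(t)`, `e^z·D(t) = E(t)`).  Consequently **D is VACUOUS on every tuple `(z, e^z)` that is an
algebraic-coefficient linear / quadratic / rational image of fewer than `n` parameters** (§1), and — by the
dichotomy «all values algebraic ⟹ h5/h6 contradict; else `v ≥ 1`» — **D is a THEOREM, with no hypothesis, on every
tuple `z` that is an argument-side quadratic / rational image of `k < n` parameters and has `trdeg ℚ(z) ≥ n − 1`**
(§2: `disjointSaturatedEssentialSchanuel_quadraticImage`, `…_rationalImage`, binders of stmt-30353 verbatim).

## Consequences for the D₃ residue (rounds 15–17 re-booked)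

* POWER PLANES `y₀·(1, ρ, ρ²)` with `(y₀, ρ)` algebraically independent are quadratic images of the two parameters
  `t = (s, sρ)`, `s² = y₀` (`y₀ = s·s`, `y₀ρ = s·(sρ)`, `y₀ρ² = (sρ)²`), with `trdeg ℚ(z) = 2 = n − 1`; hence
  **`disjointSaturatedEssentialSchanuel_powerPlane` (§3) is round 16's `…_powerPlane_of_fourExp` WITH THE
  HYPOTHESIS `FourExponentialsConjecture` DELETED, for ALL `ρ`** — it supersedes the FEC cell of round 16 and the
  σ-cells of round 17 as far as item D is concerned.  The Four-Exponentials / Schneider / σ-sieve content of those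
  rounds concerns the locus «all three values algebraic», on which D's binder h5 is FALSE
  (`not_quadraticBinder_of_values_algebraic`): that locus belongs to the QUADRATIC-IMAGE item
  Q = `QuadraticSchanuel` (stmt-28369, derived from B ∧ U⊥ by `LadderCollapseGlue`), not to D.
* PRODUCT PLANES `(u, v, uv)` (three of the four points of a `2 × 2` grid — not even a Four-Exponentials
  configuration) are decided the same way (§3).
* MEMBERS certified by Lindemann–Weierstrass alone (§4): the all-real, σ-RIGID power plane
  `z_R = e·(1, e^{√2}, e^{2√2}) = (e, e^{1+√2}, e^{1+2√2})` and the product plane `z_P = (e, e^{√2}, e^{1+√2})`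
  (`(e, e^{√2})` algebraically independent since `(1, √2)` is ℚ-free); round 16's `z_F = e^π·(1, π, π²)` is decided
  for D WITHOUT FEC (mod Nesterenko for membership only).  HONEST LABEL: at each member D is decided GIVEN its own
  binders h5 and `ε = 0` at the tuple; Schanuel at the member (e.g. `3 ≤ trdeg ℚ(e, e^{1+√2}, e^{1+2√2}, e^e, …)`)
  stays OPEN, and no value `exp(z_R i)` is known to be transcendental.
* RESIDUE MAP v4 (node text): D₃'s true residue is `[Cell(1,1) ∪ Cell(2,0)] ∩ {(z, e^z) NOT an algebraic-coefficient
  rational image of 2 parameters}` = log-type triples on NON-unirational surfaces (first stratum: cones over smooth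
  plane cubics) and curve × curve configurations with a factor of genus ≥ 1; every catalogued instrument (Baker,
  six/five/four exponentials, Roy, Brownawell–Waldschmidt) reads exponential GRIDS, i.e. rational loci.

Sorry-free; standard axioms; no `def … : Prop`, no instances, no notation.  Nothing here proves Schanuel; rung 0.
-/

noncomputable section

namespace Summit.Schanuel.Schanuel.Theorems.RootDecomp1QuadricAbsorption

open Complex IntermediateField Module Polynomial
open Literature.NumberTheory.Transcendental (algebraicIndependent_exp_holds nesterenko)
open Summit.Schanuel.Schanuel.Theorems.RootDecomp1EAnchor (isAlgebraic_of_mem_adjoin)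
open Summit.Schanuel.Schanuel.Theorems.RootDecomp1EEStableRung (one_le_trdeg_adjoin_of_transcendental)
open Summit.Schanuel.Schanuel.Theorems.RootDecomp1ArgumentCells (le_trdeg_of_algebraicIndependent_mem)
open Summit.Schanuel.Schanuel.Theorems.RootDecomp1AdditiveCells (le_trdeg_of_additive_cert)
open Summit.Schanuel.Schanuel.Theorems.RootDecomp1AdditiveCellsD (pair_one_linearIndependent)
open Summit.Schanuel.Schanuel.Theorems.RootDecomp1ResidueSieve (powerPlane powerPlane_zero powerPlane_one
  powerPlane_two powerPlane_linearIndependent two_le_argDegree_powerPlane not_isAlgebraic_of_algebraicIndependent_pair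
  expPiPowerPlane algebraicIndependent_expPi_pi)

/-! ## §1  SCOPE ABSORPTION: D's binders h4 / h5 / h6 are contradictory on linear / quadratic / rational images
of fewer than `n` parameters whose values are algebraic (value side: the constants `γ₀ i := e^{z i}`,
`E i := C(e^{z i})·D`). -/

/-- **h4 absorbs linear images.** -/
theorem absurd_of_linearImage {n : ℕ} {z : Fin n → ℂ}
    (h4 : ∀ (k : ℕ) (t : Fin k → ℂ) (β₀ γ₀ : Fin n → ℂ) (β γ : Fin n → Fin k → ℂ), (∀ i, IsAlgebraic ℚ (β₀ i)) →
      (∀ i j, IsAlgebraic ℚ (β i j)) → (∀ i, IsAlgebraic ℚ (γ₀ i)) → (∀ i j, IsAlgebraic ℚ (γ i j)) →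
      (∀ i, z i = β₀ i + ∑ j, β i j * t j) → (∀ i, Complex.exp (z i) = γ₀ i + ∑ j, γ i j * t j) → n ≤ k)
    (hval : ∀ i, IsAlgebraic ℚ (Complex.exp (z i))) {k : ℕ} (hk : k < n) (t : Fin k → ℂ) (β₀ : Fin n → ℂ)
    (β : Fin n → Fin k → ℂ) (hβ₀ : ∀ i, IsAlgebraic ℚ (β₀ i)) (hβ : ∀ i j, IsAlgebraic ℚ (β i j))
    (hz : ∀ i, z i = β₀ i + ∑ j, β i j * t j) : False := by
  have h := h4 k t β₀ (fun i => Complex.exp (z i)) β (fun _ _ => 0) hβ₀ hβ hval (fun _ _ => isAlgebraic_zero) hz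
    (fun i => by simp)
  omega

/-- **h5 absorbs quadratic images.** -/
theorem absurd_of_quadraticImage {n : ℕ} {z : Fin n → ℂ}
    (h5 : ∀ (k : ℕ) (t : Fin k → ℂ) (β₀ γ₀ : Fin n → ℂ) (β γ : Fin n → Fin k → ℂ) (δ ε : Fin n → Fin k → Fin k → ℂ),
      (∀ i, IsAlgebraic ℚ (β₀ i)) → (∀ i j, IsAlgebraic ℚ (β i j)) → (∀ i j j', IsAlgebraic ℚ (δ i j j')) →
      (∀ i, IsAlgebraic ℚ (γ₀ i)) → (∀ i j, IsAlgebraic ℚ (γ i j)) → (∀ i j j', IsAlgebraic ℚ (ε i j j')) →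
      (∀ i, z i = β₀ i + ∑ j, β i j * t j + ∑ j, ∑ j', δ i j j' * (t j * t j')) →
      (∀ i, Complex.exp (z i) = γ₀ i + ∑ j, γ i j * t j + ∑ j, ∑ j', ε i j j' * (t j * t j')) → n ≤ k)
    (hval : ∀ i, IsAlgebraic ℚ (Complex.exp (z i))) {k : ℕ} (hk : k < n) (t : Fin k → ℂ) (β₀ : Fin n → ℂ)
    (β : Fin n → Fin k → ℂ) (δ : Fin n → Fin k → Fin k → ℂ) (hβ₀ : ∀ i, IsAlgebraic ℚ (β₀ i))
    (hβ : ∀ i j, IsAlgebraic ℚ (β i j)) (hδ : ∀ i j j', IsAlgebraic ℚ (δ i j j'))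
    (hz : ∀ i, z i = β₀ i + ∑ j, β i j * t j + ∑ j, ∑ j', δ i j j' * (t j * t j')) : False := by
  have h := h5 k t β₀ (fun i => Complex.exp (z i)) β (fun _ _ => 0) δ (fun _ _ _ => 0) hβ₀ hβ hδ hval
    (fun _ _ => isAlgebraic_zero) (fun _ _ _ => isAlgebraic_zero) hz (fun i => by simp)
  omega

/-- **h6 absorbs rational images.** -/
theorem absurd_of_rationalImage {n : ℕ} {z : Fin n → ℂ}
    (h6 : ∀ (k : ℕ) (t : Fin k → ℂ) (D : MvPolynomial (Fin k) ℂ) (N E : Fin n → MvPolynomial (Fin k) ℂ),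
      (∀ m, IsAlgebraic ℚ (MvPolynomial.coeff m D)) → (∀ i m, IsAlgebraic ℚ (MvPolynomial.coeff m (N i))) →
      (∀ i m, IsAlgebraic ℚ (MvPolynomial.coeff m (E i))) → MvPolynomial.eval t D ≠ 0 →
      (∀ i, z i * MvPolynomial.eval t D = MvPolynomial.eval t (N i)) →
      (∀ i, Complex.exp (z i) * MvPolynomial.eval t D = MvPolynomial.eval t (E i)) → n ≤ k)
    (hval : ∀ i, IsAlgebraic ℚ (Complex.exp (z i))) {k : ℕ} (hk : k < n) (t : Fin k → ℂ)
    (D : MvPolynomial (Fin k) ℂ) (N : Fin n → MvPolynomial (Fin k) ℂ)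
    (hD : ∀ m, IsAlgebraic ℚ (MvPolynomial.coeff m D)) (hN : ∀ i m, IsAlgebraic ℚ (MvPolynomial.coeff m (N i)))
    (hD0 : MvPolynomial.eval t D ≠ 0) (hz : ∀ i, z i * MvPolynomial.eval t D = MvPolynomial.eval t (N i)) :
    False := by
  have h := h6 k t D N (fun i => MvPolynomial.C (Complex.exp (z i)) * D) hD hN
    (fun i m => by rw [MvPolynomial.coeff_C_mul]; exact (hval i).mul (hD m)) hD0 hz
    (fun i => by simp [MvPolynomial.eval_C])
  omega

/-- Contrapositive reading (the S/Q side): if all values are algebraic and `z` IS a quadratic image of `k < n`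
parameters, the quadratic binder h5 of item D is FALSE at `z` — such tuples are the QUADRATIC-IMAGE item's, not D's. -/
theorem not_quadraticBinder_of_values_algebraic {n : ℕ} {z : Fin n → ℂ}
    (hval : ∀ i, IsAlgebraic ℚ (Complex.exp (z i))) {k : ℕ} (hk : k < n) (t : Fin k → ℂ) (β₀ : Fin n → ℂ)
    (β : Fin n → Fin k → ℂ) (δ : Fin n → Fin k → Fin k → ℂ) (hβ₀ : ∀ i, IsAlgebraic ℚ (β₀ i))
    (hβ : ∀ i j, IsAlgebraic ℚ (β i j)) (hδ : ∀ i j j', IsAlgebraic ℚ (δ i j j'))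
    (hz : ∀ i, z i = β₀ i + ∑ j, β i j * t j + ∑ j, ∑ j', δ i j j' * (t j * t j')) :
    ¬ (∀ (k : ℕ) (t : Fin k → ℂ) (β₀ γ₀ : Fin n → ℂ) (β γ : Fin n → Fin k → ℂ) (δ ε : Fin n → Fin k → Fin k → ℂ),
      (∀ i, IsAlgebraic ℚ (β₀ i)) → (∀ i j, IsAlgebraic ℚ (β i j)) → (∀ i j j', IsAlgebraic ℚ (δ i j j')) →
      (∀ i, IsAlgebraic ℚ (γ₀ i)) → (∀ i j, IsAlgebraic ℚ (γ i j)) → (∀ i j j', IsAlgebraic ℚ (ε i j j')) →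
      (∀ i, z i = β₀ i + ∑ j, β i j * t j + ∑ j, ∑ j', δ i j j' * (t j * t j')) →
      (∀ i, Complex.exp (z i) = γ₀ i + ∑ j, γ i j * t j + ∑ j, ∑ j', ε i j j' * (t j * t j')) → n ≤ k) :=
  fun h5 => absurd_of_quadraticImage h5 hval hk t β₀ β δ hβ₀ hβ hδ hz

/-- **D IS VACUOUS ON THE RATIONAL-IMAGE SCOPE** (item form, binders of stmt-Schanuel-30353 verbatim; cell = the
antecedent of binder h6 with `k < n`): tuples `(z, e^z)` that are algebraic-coefficient rational images of fewer
than `n` parameters satisfy D trivially — they are the scope of `RationalImageSchanuel` (U⊥), not of D. -/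
theorem disjointSaturatedEssentialSchanuel_vacuous_on_rationalScope :
    ∀ (n : ℕ), 3 ≤ n → ∀ (z : Fin n → ℂ), LinearIndependent ℚ z →
      (∃ k : ℕ, k < n ∧ ∃ (t : Fin k → ℂ) (D : MvPolynomial (Fin k) ℂ) (N E : Fin n → MvPolynomial (Fin k) ℂ),
        (∀ m, IsAlgebraic ℚ (MvPolynomial.coeff m D)) ∧ (∀ i m, IsAlgebraic ℚ (MvPolynomial.coeff m (N i))) ∧
        (∀ i m, IsAlgebraic ℚ (MvPolynomial.coeff m (E i))) ∧ MvPolynomial.eval t D ≠ 0 ∧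
        (∀ i, z i * MvPolynomial.eval t D = MvPolynomial.eval t (N i)) ∧
        (∀ i, Complex.exp (z i) * MvPolynomial.eval t D = MvPolynomial.eval t (E i))) →
      (∀ i, z i ∈ Literature.NumberTheory.Transcendental.ecl (∅ : Set ℂ)) →
      (∀ (m : ℕ), m < n → ∀ (w : Fin m → ℂ), LinearIndependent ℚ w →
        (∀ i, w i ∈ Submodule.span ℚ (Set.range z)) →
        (m : Cardinal) ≤ Algebra.trdeg ℚ ↥(IntermediateField.adjoin ℚ (Set.range w ∪ Set.range (Complex.exp ∘ w)))) →
      (∀ w : ℂ, IsAlgebraic ↥(IntermediateField.adjoin ℚ (Set.range z ∪ Set.range (Complex.exp ∘ z))) w →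
        IsAlgebraic ↥(IntermediateField.adjoin ℚ (Set.range z ∪ Set.range (Complex.exp ∘ z))) (Complex.exp w) →
        w ∈ Submodule.span ℚ (Set.range z)) →
      (∀ (k : ℕ) (t : Fin k → ℂ) (β₀ γ₀ : Fin n → ℂ) (β γ : Fin n → Fin k → ℂ), (∀ i, IsAlgebraic ℚ (β₀ i)) →
        (∀ i j, IsAlgebraic ℚ (β i j)) → (∀ i, IsAlgebraic ℚ (γ₀ i)) → (∀ i j, IsAlgebraic ℚ (γ i j)) →
        (∀ i, z i = β₀ i + ∑ j, β i j * t j) → (∀ i, Complex.exp (z i) = γ₀ i + ∑ j, γ i j * t j) → n ≤ k) →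
      (∀ (k : ℕ) (t : Fin k → ℂ) (β₀ γ₀ : Fin n → ℂ) (β γ : Fin n → Fin k → ℂ) (δ ε : Fin n → Fin k → Fin k → ℂ),
        (∀ i, IsAlgebraic ℚ (β₀ i)) → (∀ i j, IsAlgebraic ℚ (β i j)) → (∀ i j j', IsAlgebraic ℚ (δ i j j')) →
        (∀ i, IsAlgebraic ℚ (γ₀ i)) → (∀ i j, IsAlgebraic ℚ (γ i j)) → (∀ i j j', IsAlgebraic ℚ (ε i j j')) →
        (∀ i, z i = β₀ i + ∑ j, β i j * t j + ∑ j, ∑ j', δ i j j' * (t j * t j')) →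
        (∀ i, Complex.exp (z i) = γ₀ i + ∑ j, γ i j * t j + ∑ j, ∑ j', ε i j j' * (t j * t j')) → n ≤ k) →
      (∀ (k : ℕ) (t : Fin k → ℂ) (D : MvPolynomial (Fin k) ℂ) (N E : Fin n → MvPolynomial (Fin k) ℂ),
        (∀ m, IsAlgebraic ℚ (MvPolynomial.coeff m D)) → (∀ i m, IsAlgebraic ℚ (MvPolynomial.coeff m (N i))) →
        (∀ i m, IsAlgebraic ℚ (MvPolynomial.coeff m (E i))) → MvPolynomial.eval t D ≠ 0 →
        (∀ i, z i * MvPolynomial.eval t D = MvPolynomial.eval t (N i)) →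
        (∀ i, Complex.exp (z i) * MvPolynomial.eval t D = MvPolynomial.eval t (E i)) → n ≤ k) →
      (Algebra.trdeg ℚ ↥(IntermediateField.adjoin ℚ (Set.range z)) +
          Algebra.trdeg ℚ ↥(IntermediateField.adjoin ℚ (Set.range (Complex.exp ∘ z))) ≤
        Algebra.trdeg ℚ ↥(IntermediateField.adjoin ℚ (Set.range z ∪ Set.range (Complex.exp ∘ z)))) →
      (n : Cardinal) ≤ Algebra.trdeg ℚ ↥(IntermediateField.adjoin ℚ (Set.range z ∪ Set.range (Complex.exp ∘ z))) := by
  intro n hn z hz hcell _ _ _ _ _ h6 _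
  obtain ⟨k, hk, t, D, N, E, hD, hN, hE, hD0, hzN, hzE⟩ := hcell
  have h := h6 k t D N E hD hN hE hD0 hzN hzE
  omega

/-! ## §2  THE DICHOTOMY: D is a THEOREM on argument-side quadratic / rational images of `k < n` parameters with
`trdeg ℚ(z) ≥ n − 1` — either all values are algebraic (then h5 / h6 are contradictory, §1) or one value is
transcendental (`v ≥ 1`) and the additive certificate `a + v ≥ (n − 1) + 1 = n` closes with `ε = 0`. -/

/-- **Pointwise, quadratic.** -/
theorem disjointSchanuel_of_quadraticImage {n : ℕ} (z : Fin n → ℂ)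
    (h5 : ∀ (k : ℕ) (t : Fin k → ℂ) (β₀ γ₀ : Fin n → ℂ) (β γ : Fin n → Fin k → ℂ) (δ ε : Fin n → Fin k → Fin k → ℂ),
      (∀ i, IsAlgebraic ℚ (β₀ i)) → (∀ i j, IsAlgebraic ℚ (β i j)) → (∀ i j j', IsAlgebraic ℚ (δ i j j')) →
      (∀ i, IsAlgebraic ℚ (γ₀ i)) → (∀ i j, IsAlgebraic ℚ (γ i j)) → (∀ i j j', IsAlgebraic ℚ (ε i j j')) →
      (∀ i, z i = β₀ i + ∑ j, β i j * t j + ∑ j, ∑ j', δ i j j' * (t j * t j')) →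
      (∀ i, Complex.exp (z i) = γ₀ i + ∑ j, γ i j * t j + ∑ j, ∑ j', ε i j j' * (t j * t j')) → n ≤ k)
    {a : ℕ} (hna : n ≤ a + 1) (ha : (a : Cardinal) ≤ Algebra.trdeg ℚ ↥(adjoin ℚ (Set.range z)))
    {k : ℕ} (hk : k < n) (t : Fin k → ℂ) (β₀ : Fin n → ℂ) (β : Fin n → Fin k → ℂ) (δ : Fin n → Fin k → Fin k → ℂ)
    (hβ₀ : ∀ i, IsAlgebraic ℚ (β₀ i)) (hβ : ∀ i j, IsAlgebraic ℚ (β i j)) (hδ : ∀ i j j', IsAlgebraic ℚ (δ i j j'))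
    (hz : ∀ i, z i = β₀ i + ∑ j, β i j * t j + ∑ j, ∑ j', δ i j j' * (t j * t j'))
    (hsplit : Algebra.trdeg ℚ ↥(adjoin ℚ (Set.range z)) + Algebra.trdeg ℚ ↥(adjoin ℚ (Set.range (cexp ∘ z))) ≤
      Algebra.trdeg ℚ ↥(adjoin ℚ (Set.range z ∪ Set.range (cexp ∘ z)))) :
    (n : Cardinal) ≤ Algebra.trdeg ℚ ↥(adjoin ℚ (Set.range z ∪ Set.range (cexp ∘ z))) := by
  by_cases hval : ∀ i, IsAlgebraic ℚ (Complex.exp (z i))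
  · exact (absurd_of_quadraticImage h5 hval hk t β₀ β δ hβ₀ hβ hδ hz).elim
  · push Not at hval
    obtain ⟨i, hi⟩ := hval
    have hv : (1 : Cardinal) ≤ Algebra.trdeg ℚ ↥(adjoin ℚ (Set.range (cexp ∘ z))) :=
      one_le_trdeg_adjoin_of_transcendental hi ⟨i, rfl⟩
    exact le_trdeg_of_additive_cert z (a := a) (v := 1) ha (by exact_mod_cast hv) hsplit (by omega)

/-- **Pointwise, rational.** -/
theorem disjointSchanuel_of_rationalImage {n : ℕ} (z : Fin n → ℂ)
    (h6 : ∀ (k : ℕ) (t : Fin k → ℂ) (D : MvPolynomial (Fin k) ℂ) (N E : Fin n → MvPolynomial (Fin k) ℂ),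
      (∀ m, IsAlgebraic ℚ (MvPolynomial.coeff m D)) → (∀ i m, IsAlgebraic ℚ (MvPolynomial.coeff m (N i))) →
      (∀ i m, IsAlgebraic ℚ (MvPolynomial.coeff m (E i))) → MvPolynomial.eval t D ≠ 0 →
      (∀ i, z i * MvPolynomial.eval t D = MvPolynomial.eval t (N i)) →
      (∀ i, Complex.exp (z i) * MvPolynomial.eval t D = MvPolynomial.eval t (E i)) → n ≤ k)
    {a : ℕ} (hna : n ≤ a + 1) (ha : (a : Cardinal) ≤ Algebra.trdeg ℚ ↥(adjoin ℚ (Set.range z)))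
    {k : ℕ} (hk : k < n) (t : Fin k → ℂ) (D : MvPolynomial (Fin k) ℂ) (N : Fin n → MvPolynomial (Fin k) ℂ)
    (hD : ∀ m, IsAlgebraic ℚ (MvPolynomial.coeff m D)) (hN : ∀ i m, IsAlgebraic ℚ (MvPolynomial.coeff m (N i)))
    (hD0 : MvPolynomial.eval t D ≠ 0) (hz : ∀ i, z i * MvPolynomial.eval t D = MvPolynomial.eval t (N i))
    (hsplit : Algebra.trdeg ℚ ↥(adjoin ℚ (Set.range z)) + Algebra.trdeg ℚ ↥(adjoin ℚ (Set.range (cexp ∘ z))) ≤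
      Algebra.trdeg ℚ ↥(adjoin ℚ (Set.range z ∪ Set.range (cexp ∘ z)))) :
    (n : Cardinal) ≤ Algebra.trdeg ℚ ↥(adjoin ℚ (Set.range z ∪ Set.range (cexp ∘ z))) := by
  by_cases hval : ∀ i, IsAlgebraic ℚ (Complex.exp (z i))
  · exact (absurd_of_rationalImage h6 hval hk t D N hD hN hD0 hz).elim
  · push Not at hval
    obtain ⟨i, hi⟩ := hval
    have hv : (1 : Cardinal) ≤ Algebra.trdeg ℚ ↥(adjoin ℚ (Set.range (cexp ∘ z))) :=
      one_le_trdeg_adjoin_of_transcendental hi ⟨i, rfl⟩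
    exact le_trdeg_of_additive_cert z (a := a) (v := 1) ha (by exact_mod_cast hv) hsplit (by omega)

/-- **D ON QUADRATIC IMAGES OF CO-DEGREE ≤ 1 (item form, binders of stmt-Schanuel-30353 verbatim; NO hypothesis).**
Cell: `trdeg ℚ(z) ≥ a ≥ n − 1` and `z` an algebraic-coefficient quadratic image of `k < n` parameters. -/
theorem disjointSaturatedEssentialSchanuel_quadraticImage :
    ∀ (n : ℕ), 3 ≤ n → ∀ (z : Fin n → ℂ), LinearIndependent ℚ z →
      ((∃ a : ℕ, n ≤ a + 1 ∧ (a : Cardinal) ≤ Algebra.trdeg ℚ ↥(IntermediateField.adjoin ℚ (Set.range z))) ∧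
        ∃ k : ℕ, k < n ∧ ∃ (t : Fin k → ℂ) (β₀ : Fin n → ℂ) (β : Fin n → Fin k → ℂ) (δ : Fin n → Fin k → Fin k → ℂ),
          (∀ i, IsAlgebraic ℚ (β₀ i)) ∧ (∀ i j, IsAlgebraic ℚ (β i j)) ∧ (∀ i j j', IsAlgebraic ℚ (δ i j j')) ∧
          ∀ i, z i = β₀ i + ∑ j, β i j * t j + ∑ j, ∑ j', δ i j j' * (t j * t j')) →
      (∀ i, z i ∈ Literature.NumberTheory.Transcendental.ecl (∅ : Set ℂ)) →
      (∀ (m : ℕ), m < n → ∀ (w : Fin m → ℂ), LinearIndependent ℚ w →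
        (∀ i, w i ∈ Submodule.span ℚ (Set.range z)) →
        (m : Cardinal) ≤ Algebra.trdeg ℚ ↥(IntermediateField.adjoin ℚ (Set.range w ∪ Set.range (Complex.exp ∘ w)))) →
      (∀ w : ℂ, IsAlgebraic ↥(IntermediateField.adjoin ℚ (Set.range z ∪ Set.range (Complex.exp ∘ z))) w →
        IsAlgebraic ↥(IntermediateField.adjoin ℚ (Set.range z ∪ Set.range (Complex.exp ∘ z))) (Complex.exp w) →
        w ∈ Submodule.span ℚ (Set.range z)) →
      (∀ (k : ℕ) (t : Fin k → ℂ) (β₀ γ₀ : Fin n → ℂ) (β γ : Fin n → Fin k → ℂ), (∀ i, IsAlgebraic ℚ (β₀ i)) →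
        (∀ i j, IsAlgebraic ℚ (β i j)) → (∀ i, IsAlgebraic ℚ (γ₀ i)) → (∀ i j, IsAlgebraic ℚ (γ i j)) →
        (∀ i, z i = β₀ i + ∑ j, β i j * t j) → (∀ i, Complex.exp (z i) = γ₀ i + ∑ j, γ i j * t j) → n ≤ k) →
      (∀ (k : ℕ) (t : Fin k → ℂ) (β₀ γ₀ : Fin n → ℂ) (β γ : Fin n → Fin k → ℂ) (δ ε : Fin n → Fin k → Fin k → ℂ),
        (∀ i, IsAlgebraic ℚ (β₀ i)) → (∀ i j, IsAlgebraic ℚ (β i j)) → (∀ i j j', IsAlgebraic ℚ (δ i j j')) →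
        (∀ i, IsAlgebraic ℚ (γ₀ i)) → (∀ i j, IsAlgebraic ℚ (γ i j)) → (∀ i j j', IsAlgebraic ℚ (ε i j j')) →
        (∀ i, z i = β₀ i + ∑ j, β i j * t j + ∑ j, ∑ j', δ i j j' * (t j * t j')) →
        (∀ i, Complex.exp (z i) = γ₀ i + ∑ j, γ i j * t j + ∑ j, ∑ j', ε i j j' * (t j * t j')) → n ≤ k) →
      (∀ (k : ℕ) (t : Fin k → ℂ) (D : MvPolynomial (Fin k) ℂ) (N E : Fin n → MvPolynomial (Fin k) ℂ),
        (∀ m, IsAlgebraic ℚ (MvPolynomial.coeff m D)) → (∀ i m, IsAlgebraic ℚ (MvPolynomial.coeff m (N i))) →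
        (∀ i m, IsAlgebraic ℚ (MvPolynomial.coeff m (E i))) → MvPolynomial.eval t D ≠ 0 →
        (∀ i, z i * MvPolynomial.eval t D = MvPolynomial.eval t (N i)) →
        (∀ i, Complex.exp (z i) * MvPolynomial.eval t D = MvPolynomial.eval t (E i)) → n ≤ k) →
      (Algebra.trdeg ℚ ↥(IntermediateField.adjoin ℚ (Set.range z)) +
          Algebra.trdeg ℚ ↥(IntermediateField.adjoin ℚ (Set.range (Complex.exp ∘ z))) ≤
        Algebra.trdeg ℚ ↥(IntermediateField.adjoin ℚ (Set.range z ∪ Set.range (Complex.exp ∘ z)))) →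
      (n : Cardinal) ≤ Algebra.trdeg ℚ ↥(IntermediateField.adjoin ℚ (Set.range z ∪ Set.range (Complex.exp ∘ z))) := by
  intro n hn z hz hcell _ _ _ _ h5 _ hsplit
  obtain ⟨⟨a, hna, ha⟩, k, hk, t, β₀, β, δ, hβ₀, hβ, hδ, hzq⟩ := hcell
  exact disjointSchanuel_of_quadraticImage z h5 hna ha hk t β₀ β δ hβ₀ hβ hδ hzq hsplit

/-- **D ON RATIONAL IMAGES OF CO-DEGREE ≤ 1 (item form, binders of stmt-Schanuel-30353 verbatim; NO hypothesis).**
Cell: `trdeg ℚ(z) ≥ a ≥ n − 1` and `z·D(t) = N(t)`, an algebraic-coefficient rational image of `k < n` parameters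
(argument side only). -/
theorem disjointSaturatedEssentialSchanuel_rationalImage :
    ∀ (n : ℕ), 3 ≤ n → ∀ (z : Fin n → ℂ), LinearIndependent ℚ z →
      ((∃ a : ℕ, n ≤ a + 1 ∧ (a : Cardinal) ≤ Algebra.trdeg ℚ ↥(IntermediateField.adjoin ℚ (Set.range z))) ∧
        ∃ k : ℕ, k < n ∧ ∃ (t : Fin k → ℂ) (D : MvPolynomial (Fin k) ℂ) (N : Fin n → MvPolynomial (Fin k) ℂ),
          (∀ m, IsAlgebraic ℚ (MvPolynomial.coeff m D)) ∧ (∀ i m, IsAlgebraic ℚ (MvPolynomial.coeff m (N i))) ∧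
          MvPolynomial.eval t D ≠ 0 ∧ ∀ i, z i * MvPolynomial.eval t D = MvPolynomial.eval t (N i)) →
      (∀ i, z i ∈ Literature.NumberTheory.Transcendental.ecl (∅ : Set ℂ)) →
      (∀ (m : ℕ), m < n → ∀ (w : Fin m → ℂ), LinearIndependent ℚ w →
        (∀ i, w i ∈ Submodule.span ℚ (Set.range z)) →
        (m : Cardinal) ≤ Algebra.trdeg ℚ ↥(IntermediateField.adjoin ℚ (Set.range w ∪ Set.range (Complex.exp ∘ w)))) →
      (∀ w : ℂ, IsAlgebraic ↥(IntermediateField.adjoin ℚ (Set.range z ∪ Set.range (Complex.exp ∘ z))) w →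
        IsAlgebraic ↥(IntermediateField.adjoin ℚ (Set.range z ∪ Set.range (Complex.exp ∘ z))) (Complex.exp w) →
        w ∈ Submodule.span ℚ (Set.range z)) →
      (∀ (k : ℕ) (t : Fin k → ℂ) (β₀ γ₀ : Fin n → ℂ) (β γ : Fin n → Fin k → ℂ), (∀ i, IsAlgebraic ℚ (β₀ i)) →
        (∀ i j, IsAlgebraic ℚ (β i j)) → (∀ i, IsAlgebraic ℚ (γ₀ i)) → (∀ i j, IsAlgebraic ℚ (γ i j)) →
        (∀ i, z i = β₀ i + ∑ j, β i j * t j) → (∀ i, Complex.exp (z i) = γ₀ i + ∑ j, γ i j * t j) → n ≤ k) →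
      (∀ (k : ℕ) (t : Fin k → ℂ) (β₀ γ₀ : Fin n → ℂ) (β γ : Fin n → Fin k → ℂ) (δ ε : Fin n → Fin k → Fin k → ℂ),
        (∀ i, IsAlgebraic ℚ (β₀ i)) → (∀ i j, IsAlgebraic ℚ (β i j)) → (∀ i j j', IsAlgebraic ℚ (δ i j j')) →
        (∀ i, IsAlgebraic ℚ (γ₀ i)) → (∀ i j, IsAlgebraic ℚ (γ i j)) → (∀ i j j', IsAlgebraic ℚ (ε i j j')) →
        (∀ i, z i = β₀ i + ∑ j, β i j * t j + ∑ j, ∑ j', δ i j j' * (t j * t j')) →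
        (∀ i, Complex.exp (z i) = γ₀ i + ∑ j, γ i j * t j + ∑ j, ∑ j', ε i j j' * (t j * t j')) → n ≤ k) →
      (∀ (k : ℕ) (t : Fin k → ℂ) (D : MvPolynomial (Fin k) ℂ) (N E : Fin n → MvPolynomial (Fin k) ℂ),
        (∀ m, IsAlgebraic ℚ (MvPolynomial.coeff m D)) → (∀ i m, IsAlgebraic ℚ (MvPolynomial.coeff m (N i))) →
        (∀ i m, IsAlgebraic ℚ (MvPolynomial.coeff m (E i))) → MvPolynomial.eval t D ≠ 0 →
        (∀ i, z i * MvPolynomial.eval t D = MvPolynomial.eval t (N i)) →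
        (∀ i, Complex.exp (z i) * MvPolynomial.eval t D = MvPolynomial.eval t (E i)) → n ≤ k) →
      (Algebra.trdeg ℚ ↥(IntermediateField.adjoin ℚ (Set.range z)) +
          Algebra.trdeg ℚ ↥(IntermediateField.adjoin ℚ (Set.range (Complex.exp ∘ z))) ≤
        Algebra.trdeg ℚ ↥(IntermediateField.adjoin ℚ (Set.range z ∪ Set.range (Complex.exp ∘ z)))) →
      (n : Cardinal) ≤ Algebra.trdeg ℚ ↥(IntermediateField.adjoin ℚ (Set.range z ∪ Set.range (Complex.exp ∘ z))) := by
  intro n hn z hz hcell _ _ _ _ _ h6 hsplit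
  obtain ⟨⟨a, hna, ha⟩, k, hk, t, D, N, hD, hN, hD0, hzN⟩ := hcell
  exact disjointSchanuel_of_rationalImage z h6 hna ha hk t D N hD hN hD0 hzN hsplit

end Summit.Schanuel.Schanuel.Theorems.RootDecomp1QuadricAbsorption
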